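import Summits.CriticalPhenomena.Ising3DConformalLimit.Theses.MarkovRigidity
import HarnessLib

/-!
# `MarkovRigidity.CubicClosure` (item stmt-CriticalPhenomena-6230), proved

THEOREM-ONLY file (no definitions, no named facts). The glue item `CubicClosure` (support #9) of
route `MarkovRigidity` for the conjunct `Ising3DConformalLimit`, "an `O_h`-invariant metric is
round": for `Δ > 0`, a correlation family `S` on `ℝ³` with `S₂ > 0` on non-coincident pairs which
is invariant under all signed-permutation (hyperoctahedral, `B₃`) linear isometries, and a
continuous linear automorphism `A` of `ℝ³` such that `S ∘ A` is Möbius covariant of weight `Δ`,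
the family `S` itself is Möbius covariant of weight `Δ`.

Proof (as in the route docstring). Write `T = S ∘ A`, `B = A⁻¹`, so `S n y = T n (B ∘ y)`.
Rotation invariance and scale covariance of `T` give `T₂(0,u) = ‖u‖^{-2Δ} g₀` with
`g₀ = T₂(0,e₀) = S₂(0, A e₀) > 0`; hence `S₂(0,w) = ‖B w‖^{-2Δ} g₀`, and `B₃`-invariance of `S`
with `Δ ≠ 0` gives `‖B (L w)‖ = ‖B w‖` for every signed permutation `L`. Sign flips make the
vectors `B eᵢ` pairwise orthogonal, transpositions give them a common length `μ > 0`, so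
`μ⁻¹ B` maps the standard orthonormal basis to an orthonormal family and is a linear isometry `R`
(`LinearEquiv.isometryOfOrthonormal`). Finally `S n y = T n (μ • R ∘ y) = μ^{-nΔ} T n (R ∘ y)`, and
Möbius covariance is stable under precomposition with a linear isometry and under `n`-dependent
constants.

References: P. Di Francesco, P. Mathieu, D. Sénéchal, *Conformal Field Theory* (Springer 1997),
§4.1, §4.3.1 (Möbius covariance of quasi-primary correlators); D. Poland, S. Rychkov, A. Vichi,
Rev. Mod. Phys. 91 (2019) 015002 (context only).
-/

noncomputable section

namespace Summit.CriticalPhenomena.Ising3DConformalLimit.Theorems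

open Literature.Probability.LatticeModels EuclideanGeometry
open Summit.CriticalPhenomena.Ising3DConformalLimit.Theses

namespace MarkovRigidityCubicClosure

variable {d : ℕ}

/-! ### Two-point configurations `![a, b]` under maps -/

/-- Applying a map coordinatewise to the two-point configuration `![a, b]` gives `![f a, f b]`.
[folklore] -/
theorem comp_vecTwo {α β : Type*} (f : α → β) (a b : α) :
    (fun i => f ((![a, b] : Fin 2 → α) i)) = ![f a, f b] := by
  funext i
  fin_cases i <;> rfl

/-- A two-point configuration `![a, b]` with `a ≠ b` is non-coincident (injective). [folklore] -/
theorem injective_vecTwo {α : Type*} {a b : α} (h : a ≠ b) :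
    Function.Injective (![a, b] : Fin 2 → α) := by
  intro i j hij
  fin_cases i <;> fin_cases j
  · rfl
  · exact absurd hij h
  · exact absurd hij.symm h
  · rfl

/-- The unit inversion about the origin of a normed space is `x ↦ (1/‖x‖)² • x`
(Di Francesco–Mathieu–Sénéchal 1997, §4.1, eq. (4.15); Mathlib `EuclideanGeometry.inversion`).
[folklore] -/
theorem inversion_zero_one_eq_smul (x : EuclideanSpace ℝ (Fin d)) :
    inversion (0 : EuclideanSpace ℝ (Fin d)) 1 x = ((1 / ‖x‖) ^ 2) • x := by
  rw [inversion, vsub_eq_sub, sub_zero, vadd_eq_add, add_zero, dist_zero_right]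

/-- A linear isometry commutes with the unit inversion about the origin. [folklore] -/
theorem map_inversion_zero_one
    (R : EuclideanSpace ℝ (Fin d) ≃ₗᵢ[ℝ] EuclideanSpace ℝ (Fin d)) (y : EuclideanSpace ℝ (Fin d)) :
    R (inversion (0 : EuclideanSpace ℝ (Fin d)) 1 y) =
      inversion (0 : EuclideanSpace ℝ (Fin d)) 1 (R y) := by
  rw [inversion_zero_one_eq_smul, inversion_zero_one_eq_smul, LinearIsometryEquiv.map_smul,
    LinearIsometryEquiv.norm_map]

/-! ### Stability of Möbius covariance -/

/-- Möbius covariance of weight `Δ` is stable under precomposition of every point with a fixed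
linear isometry `R ∈ O(d)`: translations, orthogonal maps and dilations are conjugated into maps
of the same kind, and `R` commutes with the unit inversion and preserves norms.
(Di Francesco–Mathieu–Sénéchal 1997, §4.3.1.) [folklore] -/
theorem isMoebiusCovariant_comp {Δ : ℝ} {T : CorrFamily d} (hT : IsMoebiusCovariant Δ T)
    (R : EuclideanSpace ℝ (Fin d) ≃ₗᵢ[ℝ] EuclideanSpace ℝ (Fin d)) :
    IsMoebiusCovariant Δ (fun n x => T n (fun i => R (x i))) := by
  obtain ⟨⟨htr, hrot⟩, hsc, hinv⟩ := hT
  refine ⟨⟨fun n v x => ?_, fun n R' x => ?_⟩, fun n c hc x => ?_, fun n x hx => ?_⟩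
  · dsimp only
    simp only [map_add]
    exact htr n (R v) (fun i => R (x i))
  · dsimp only
    have h1 := hrot n (R'.trans R) x
    have h2 := hrot n R x
    simp only [LinearIsometryEquiv.coe_trans, Function.comp_apply] at h1
    rw [h1, h2]
  · dsimp only
    simp only [LinearIsometryEquiv.map_smul]
    exact hsc n c hc (fun i => R (x i))
  · dsimp only
    have hRx : ∀ i, R (x i) ≠ 0 := fun i h => hx i ((LinearIsometryEquiv.map_eq_zero_iff R).1 h)
    simp only [map_inversion_zero_one]
    have h := hinv n (fun i => R (x i)) hRx
    simp only [LinearIsometryEquiv.norm_map] at h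
    exact h

/-- Möbius covariance of weight `Δ` is stable under multiplication of the `n`-point functions by
`n`-dependent constants (every covariance identity is linear in `S n` for fixed `n`).
(Di Francesco–Mathieu–Sénéchal 1997, §4.3.1.) [folklore] -/
theorem isMoebiusCovariant_const_mul {Δ : ℝ} {T : CorrFamily d} (hT : IsMoebiusCovariant Δ T)
    (c : ℕ → ℝ) : IsMoebiusCovariant Δ (fun n x => c n * T n x) := by
  obtain ⟨⟨htr, hrot⟩, hsc, hinv⟩ := hT
  refine ⟨⟨fun n v x => ?_, fun n R' x => ?_⟩, fun n a ha x => ?_, fun n x hx => ?_⟩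
  · dsimp only
    rw [htr n v x]
  · dsimp only
    rw [hrot n R' x]
  · dsimp only
    rw [hsc n a ha x]
    ring
  · dsimp only
    rw [hinv n x hx]
    ring

/-! ### Two-point consequences of rotation invariance and scale covariance -/

/-- Scale covariance on the two-point configuration `![0, u]`:
`T₂(0, c • u) = c^{-2Δ} T₂(0, u)` for `c > 0`. [folklore] -/
theorem two_point_smul {Δ : ℝ} {T : CorrFamily d} (hsc : IsScaleCovariant Δ T) {c : ℝ}
    (hc : 0 < c) (u : EuclideanSpace ℝ (Fin d)) :
    T 2 ![0, c • u] = c ^ (-(2 : ℝ) * Δ) * T 2 ![0, u] := by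
  have h := hsc 2 c hc ![0, u]
  rw [comp_vecTwo (fun x => c • x) 0 u, smul_zero] at h
  simpa only [Nat.cast_ofNat] using h

/-- Rotation invariance on the two-point configuration `![0, u]`: `T₂(0, R u) = T₂(0, u)`.
[folklore] -/
theorem two_point_map {T : CorrFamily d} (hrot : IsRotationInvariant T)
    (R : EuclideanSpace ℝ (Fin d) ≃ₗᵢ[ℝ] EuclideanSpace ℝ (Fin d)) (u : EuclideanSpace ℝ (Fin d)) :
    T 2 ![0, R u] = T 2 ![0, u] := by
  have h := hrot 2 R ![0, u]
  rw [comp_vecTwo R 0 u, map_zero] at h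
  exact h

/-- A rotation-invariant, scale-covariant family has a radial two-point function:
`T₂(0, u) = ‖u‖^{-2Δ} · T₂(0, e)` for every `u ≠ 0` and every unit vector `e` (`O(d)` acts
transitively on spheres: the reflection in `(u/‖u‖ - e)ᗮ` maps `u/‖u‖` to `e`).
(Di Francesco–Mathieu–Sénéchal 1997, §4.3.1, eq. (4.55).) [folklore] -/
theorem two_point_radial {Δ : ℝ} {T : CorrFamily d} (hrot : IsRotationInvariant T)
    (hsc : IsScaleCovariant Δ T) {e : EuclideanSpace ℝ (Fin d)} (he : ‖e‖ = 1)
    {u : EuclideanSpace ℝ (Fin d)} (hu : u ≠ 0) :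
    T 2 ![0, u] = ‖u‖ ^ (-(2 : ℝ) * Δ) * T 2 ![0, e] := by
  have hupos : 0 < ‖u‖ := norm_pos_iff.2 hu
  have hu₁ : ‖‖u‖⁻¹ • u‖ = ‖e‖ := by
    rw [norm_smul, norm_inv, norm_norm, inv_mul_cancel₀ hupos.ne', he]
  have hR : (Submodule.span ℝ {‖u‖⁻¹ • u - e})ᗮ.reflection (‖u‖⁻¹ • u) = e :=
    Submodule.reflection_sub hu₁
  have h1 : T 2 ![0, u] = ‖u‖ ^ (-(2 : ℝ) * Δ) * T 2 ![0, ‖u‖⁻¹ • u] := by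
    rw [← two_point_smul hsc hupos, smul_smul, mul_inv_cancel₀ hupos.ne', one_smul]
  rw [h1, ← two_point_map hrot ((Submodule.span ℝ {‖u‖⁻¹ • u - e})ᗮ.reflection) (‖u‖⁻¹ • u), hR]

/-! ### Signed permutations of `ℝ³` -/

/-- The coordinate sign flip `x ↦ (…, -x_a, …)` is a signed-permutation linear isometry of `ℝ³`
sending `e_a ↦ -e_a` and fixing the other basis vectors. [folklore] -/
theorem exists_signFlip (a : Fin 3) :
    ∃ L : EuclideanSpace ℝ (Fin 3) ≃ₗᵢ[ℝ] EuclideanSpace ℝ (Fin 3),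
      (∀ i : Fin 3, ∃ j : Fin 3, L (EuclideanSpace.single i 1) = EuclideanSpace.single j 1 ∨
        L (EuclideanSpace.single i 1) = -EuclideanSpace.single j 1) ∧
      L (EuclideanSpace.single a 1) = -EuclideanSpace.single a 1 ∧
      ∀ b : Fin 3, b ≠ a → L (EuclideanSpace.single b 1) = EuclideanSpace.single b 1 := by
  set L : EuclideanSpace ℝ (Fin 3) ≃ₗᵢ[ℝ] EuclideanSpace ℝ (Fin 3) :=
    LinearIsometryEquiv.piLpCongrRight 2 fun k : Fin 3 =>
      if k = a then LinearIsometryEquiv.neg ℝ else LinearIsometryEquiv.refl ℝ ℝ with hLdef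
  have key : ∀ i : Fin 3, L (EuclideanSpace.single i 1) =
      if i = a then -EuclideanSpace.single i 1 else EuclideanSpace.single i 1 := by
    intro i
    rw [hLdef, EuclideanSpace.single, LinearIsometryEquiv.piLpCongrRight_single]
    by_cases h : i = a
    · simp [h, PiLp.single_neg]
    · simp [h]
  refine ⟨L, fun i => ⟨i, ?_⟩, ?_, fun b hb => ?_⟩
  · rw [key i]
    by_cases h : i = a
    · exact Or.inr (by rw [if_pos h])
    · exact Or.inl (by rw [if_neg h])
  · rw [key a, if_pos rfl]
  · rw [key b, if_neg hb]

/-- The coordinate transposition `x ↦ x ∘ (a b)` is a signed-permutation linear isometry of `ℝ³`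
sending `e_a ↦ e_b`. [folklore] -/
theorem exists_swap (a b : Fin 3) :
    ∃ L : EuclideanSpace ℝ (Fin 3) ≃ₗᵢ[ℝ] EuclideanSpace ℝ (Fin 3),
      (∀ i : Fin 3, ∃ j : Fin 3, L (EuclideanSpace.single i 1) = EuclideanSpace.single j 1 ∨
        L (EuclideanSpace.single i 1) = -EuclideanSpace.single j 1) ∧
      L (EuclideanSpace.single a 1) = EuclideanSpace.single b 1 := by
  refine ⟨LinearIsometryEquiv.piLpCongrLeft 2 ℝ ℝ (Equiv.swap a b), fun i => ⟨Equiv.swap a b i,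
    Or.inl (EuclideanSpace.piLpCongrLeft_single _ _ _)⟩, ?_⟩
  rw [EuclideanSpace.piLpCongrLeft_single, Equiv.swap_apply_left]

end MarkovRigidityCubicClosure

open MarkovRigidityCubicClosure in
/-- **`CubicClosure` (item stmt-CriticalPhenomena-6230 of route `MarkovRigidity`), proved** —
"an `O_h`-invariant metric is round": for `Δ > 0`, a correlation family `S` on `ℝ³` with
`S₂ > 0` on non-coincident pairs, invariant under every signed-permutation linear isometry, and a
continuous linear automorphism `A` with `S ∘ A` Möbius covariant of weight `Δ`, the family `S` is
Möbius covariant of weight `Δ`. With `T = S ∘ A`, `B = A⁻¹`: `T₂(0,u) = ‖u‖^{-2Δ} g₀`, `g₀ > 0`,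
so `B₃`-invariance of `S₂(0,w) = ‖Bw‖^{-2Δ} g₀` and `Δ ≠ 0` give `‖B(Lw)‖ = ‖Bw‖` for signed
permutations `L`; sign flips make the `B eᵢ` orthogonal, transpositions make their norms equal
(`= μ > 0`), so `R = μ⁻¹B ∈ O(3)` and `S n = μ^{-nΔ} · (T ∘ R) n` is Möbius covariant.
(Di Francesco–Mathieu–Sénéchal 1997, §4.1, §4.3.1.) Settles item stmt-CriticalPhenomena-6230
(exact signature). [folklore] -/
theorem CubicClosure_proof : MarkovRigidity.CubicClosure := by
  intro Δ S A hΔ hnd hL hT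
  set T : CorrFamily 3 := fun n x => S n (fun i => A (x i)) with hTdef
  set B : EuclideanSpace ℝ (Fin 3) ≃L[ℝ] EuclideanSpace ℝ (Fin 3) := A.symm with hBdef
  have hST : ∀ (n : ℕ) (y : Fin n → EuclideanSpace ℝ (Fin 3)),
      S n y = T n (fun i => B (y i)) := by
    intro n y
    simp only [hTdef, hBdef, ContinuousLinearEquiv.apply_symm_apply]
  obtain ⟨⟨-, hrot⟩, hsc, -⟩ := id hT
  have hB0 : ∀ w : EuclideanSpace ℝ (Fin 3), w ≠ 0 → B w ≠ 0 := fun w hw h =>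
    hw ((ContinuousLinearEquiv.map_eq_zero_iff B).1 h)
  have he_norm : ∀ i : Fin 3, ‖(EuclideanSpace.single i (1 : ℝ) : EuclideanSpace ℝ (Fin 3))‖ = 1 :=
    fun i => by simp
  have he_ne : ∀ i : Fin 3, (EuclideanSpace.single i (1 : ℝ) : EuclideanSpace ℝ (Fin 3)) ≠ 0 :=
    fun i => by simp
  -- the constant `g₀ = T₂(0, e₀) = S₂(0, A e₀) > 0`
  set g₀ : ℝ := T 2 ![0, EuclideanSpace.single (0 : Fin 3) (1 : ℝ)] with hg₀def
  have hg₀ : 0 < g₀ := by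
    have hg : g₀ = S 2 ![0, A (EuclideanSpace.single (0 : Fin 3) (1 : ℝ))] := by
      rw [hg₀def, hTdef]
      dsimp only
      rw [comp_vecTwo A, map_zero]
    rw [hg]
    refine hnd _ ((mem_nonCoincident _).2 (injective_vecTwo fun h => ?_))
    exact he_ne 0 ((ContinuousLinearEquiv.map_eq_zero_iff A).1 h.symm)
  -- `S₂(0, w) = ‖B w‖^{-2Δ} g₀`
  have hS2 : ∀ w : EuclideanSpace ℝ (Fin 3), w ≠ 0 →
      S 2 ![0, w] = ‖B w‖ ^ (-(2 : ℝ) * Δ) * g₀ := by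
    intro w hw
    rw [hST, comp_vecTwo B, map_zero, two_point_radial hrot hsc (he_norm 0) (hB0 w hw)]
  -- `‖B (L w)‖ = ‖B w‖` for every signed permutation `L`
  have hp : -(2 : ℝ) * Δ ≠ 0 := by nlinarith
  have hN : ∀ L : EuclideanSpace ℝ (Fin 3) ≃ₗᵢ[ℝ] EuclideanSpace ℝ (Fin 3),
      (∀ i : Fin 3, ∃ j : Fin 3, L (EuclideanSpace.single i 1) = EuclideanSpace.single j 1 ∨
        L (EuclideanSpace.single i 1) = -EuclideanSpace.single j 1) →
      ∀ w : EuclideanSpace ℝ (Fin 3), ‖B (L w)‖ = ‖B w‖ := by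
    intro L hLs w
    by_cases hw : w = 0
    · simp [hw]
    have hLw : L w ≠ 0 := fun h => hw ((LinearIsometryEquiv.map_eq_zero_iff L).1 h)
    have h := hL L hLs 2 ![0, w]
    rw [comp_vecTwo L, map_zero, hS2 w hw, hS2 (L w) hLw] at h
    have h' := mul_right_cancel₀ hg₀.ne' h
    calc ‖B (L w)‖ = (‖B (L w)‖ ^ (-(2 : ℝ) * Δ)) ^ (-(2 : ℝ) * Δ)⁻¹ :=
          (Real.rpow_rpow_inv (norm_nonneg _) hp).symm
      _ = (‖B w‖ ^ (-(2 : ℝ) * Δ)) ^ (-(2 : ℝ) * Δ)⁻¹ := by rw [h']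
      _ = ‖B w‖ := Real.rpow_rpow_inv (norm_nonneg _) hp
  -- the vectors `B eᵢ` are pairwise orthogonal (sign flips) ...
  have horth : ∀ i j : Fin 3, i ≠ j →
      inner ℝ (B (EuclideanSpace.single i (1 : ℝ))) (B (EuclideanSpace.single j (1 : ℝ))) = 0 := by
    intro i j hij
    obtain ⟨L, hLs, hLi, hLo⟩ := exists_signFlip i
    have h := hN L hLs (EuclideanSpace.single i 1 + EuclideanSpace.single j 1)
    rw [map_add, hLi, hLo j (Ne.symm hij), map_add, map_add, map_neg, neg_add_eq_sub] at h
    have h2 : ‖B (EuclideanSpace.single j 1) - B (EuclideanSpace.single i 1)‖ ^ 2 =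
        ‖B (EuclideanSpace.single i 1) + B (EuclideanSpace.single j 1)‖ ^ 2 := by rw [h]
    rw [norm_sub_sq_real, norm_add_sq_real, real_inner_comm] at h2
    linarith
  -- ... and have a common norm `μ > 0` (transpositions)
  have hnorm : ∀ i j : Fin 3,
      ‖B (EuclideanSpace.single j (1 : ℝ))‖ = ‖B (EuclideanSpace.single i (1 : ℝ))‖ := by
    intro i j
    obtain ⟨L, hLs, hLij⟩ := exists_swap i j
    have h := hN L hLs (EuclideanSpace.single i 1)
    rwa [hLij] at h
  set μ : ℝ := ‖B (EuclideanSpace.single (0 : Fin 3) (1 : ℝ))‖ with hμdef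
  have hμ : 0 < μ := norm_pos_iff.2 (hB0 _ (he_ne 0))
  -- `R = μ⁻¹ B` is a linear isometry
  set f : EuclideanSpace ℝ (Fin 3) ≃ₗ[ℝ] EuclideanSpace ℝ (Fin 3) :=
    B.toLinearEquiv.trans (LinearEquiv.smulOfNeZero ℝ (EuclideanSpace ℝ (Fin 3)) μ⁻¹
      (inv_ne_zero hμ.ne')) with hfdef
  have hf_apply : ∀ w, f w = μ⁻¹ • B w := fun w => rfl
  have hv : Orthonormal ℝ ⇑(EuclideanSpace.basisFun (Fin 3) ℝ).toBasis := by
    rw [OrthonormalBasis.coe_toBasis]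
    exact (EuclideanSpace.basisFun (Fin 3) ℝ).orthonormal
  have hfv : Orthonormal ℝ (⇑f ∘ ⇑(EuclideanSpace.basisFun (Fin 3) ℝ).toBasis) := by
    rw [orthonormal_iff_ite]
    intro i j
    rw [Function.comp_apply, Function.comp_apply, OrthonormalBasis.coe_toBasis,
      EuclideanSpace.basisFun_apply, EuclideanSpace.basisFun_apply, hf_apply, hf_apply,
      real_inner_smul_left, real_inner_smul_right]
    by_cases hij : i = j
    · subst hij
      rw [if_pos rfl, real_inner_self_eq_norm_sq, hnorm 0 i, ← hμdef]
      field_simp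
    · rw [if_neg hij, horth i j hij, mul_zero, mul_zero]
  set R : EuclideanSpace ℝ (Fin 3) ≃ₗᵢ[ℝ] EuclideanSpace ℝ (Fin 3) :=
    f.isometryOfOrthonormal hv hfv with hRdef
  have hBR : ∀ w, B w = μ • R w := by
    intro w
    rw [hRdef, LinearEquiv.coe_isometryOfOrthonormal, hf_apply, smul_smul,
      mul_inv_cancel₀ hμ.ne', one_smul]
  -- conclusion: `S n = μ^{-nΔ} · (T ∘ R) n`
  have hSeq : S = fun (n : ℕ) (y : Fin n → EuclideanSpace ℝ (Fin 3)) =>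
      μ ^ (-(n : ℝ) * Δ) * T n (fun i => R (y i)) := by
    funext n y
    rw [hST n y]
    simp only [hBR]
    exact hsc n μ hμ (fun i => R (y i))
  rw [hSeq]
  exact isMoebiusCovariant_const_mul (isMoebiusCovariant_comp hT R) (fun n => μ ^ (-(n : ℝ) * Δ))

end Summit.CriticalPhenomena.Ising3DConformalLimit.Theorems

end
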